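import Mathlib
import Literature.NumberTheory.LFunctions.Zhang2022.Section14MeanSquareMajorant
import Literature.NumberTheory.LFunctions.Zhang2022.SkeletonMeanValue

/-!
# Zhang (2022) Appendix A, proof of Lemma 16.1 (i): `κ₂` at prime powers and `κ̃₂(qʳ;d)` in closed form

Topic `Literature/NumberTheory/LFunctions/Zhang2022` (Landau–Siegel audit tree; verdict-neutral).
Y. Zhang, *Discrete mean estimates and the Landau–Siegel zero*, arXiv:2211.02515v1 (2022)
[Zhang2022LandauSiegel] — **an unrefereed manuscript under adjudication**; this file PROVES elementary
identities about explicitly defined objects of the tree and asserts nothing about the manuscript's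
theorems. Campaign D-0069, DAG nodes `Z22:Lem16.1.pf`, `Z22:§A.u033`–`Z22:§A.u035` [Z22 p. 105,
tex L5194–5204], feeding `Z22:Lem16.1` [Z22 p. 92, tex L4579] and the chain `Skeleton.Ded1617`.

The manuscript (App. A, proof of Lemma 16.1, p. 105): "For any `q, r, d, l` we have
`ξ₂(qʳ;d,l) = κ̃₂(qʳ;d) − χ(q)q/(q−1)·κ₂(q^{r−1})` if `(q,l) = 1`, `= κ̃₂(qʳ;d)` if `q ∣ l`;
`|κ₂(qʳ)| = |q^{−β₁} − 1| ≪ α log q`." Here `κ₂` is given by `Σ κ₂(n)n^{−s} = ζ(s+β₁)/ζ(s)` (§16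
p. 89), i.e. the tree's `MeanSquareMajorant.kappa₂ b₁ = n^{−ib₁} ∗ μ` (`β₁ = ib₁`), and
`κ̃₂(m;r) = Σ_{h∈𝔫(m),(h,r)=1} κ₂(mh)χ(h)/h` (§16 p. 90, `𝔫(d)` = `Skeleton.nset d`).

Kernel-checked here: `kappa₂_apply_prime_pow_succ` (**`κ₂(qʲ⁺¹) = wʲ(w − 1)`**, `w = q^{−ib₁}`),
`norm_kappa₂_prime_pow_succ` (**`|κ₂(qʳ)| = |q^{−β₁} − 1|`**) and `…_le` (`≤ |b₁| log q`);
`mem_nset_prime_pow_iff`, `tsum_nset_prime_pow` (a series over `h ∈ 𝔫(qʳ)` is the series over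
`h = qⁱ`); `tsum_kappa₂_prime_pow_mul_pow` (**`Σ_i κ₂(q^{r+1+i})zⁱ = wʳ(w−1)/(1−wz)`**, which at
`z = χ(q)/q` is `κ̃₂(qʳ⁺¹;d)` for `(q,d) = 1`). Companion: `AppendixAEulerFactorM2` (the Euler factor
of `𝔪₂(1,1;s)` in closed form and its estimates).

## References
* Y. Zhang, arXiv:2211.02515v1 (2022), §16 pp. 89–90 (`κ₂`, `κ̃₂`, (16.7)), Appendix A p. 105
  (proof of Lemma 16.1). [cite: Zhang2022LandauSiegel, §16, App. A]
-/

noncomputable section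

open Complex Real Finset Filter Topology
open ArithmeticFunction hiding log

namespace Literature.NumberTheory.LFunctions.Zhang2022.AppendixA

open MeanSquareMajorant

/-! ## §1. `κ₂ = n^{−β₁} ∗ μ` at prime powers (App. A p. 105: `|κ₂(qʳ)| = |q^{−β₁} − 1|`) -/

/-- `n ↦ n^{−ib}` is completely multiplicative: `(mn)^{−ib} = m^{−ib} n^{−ib}` (`m, n ≥ 1`) — the
coefficients of `ζ(s+β₁)` in "`Σ κ₂(n)n^{−s} = ζ(s+β₁)/ζ(s)`" (§16 p. 89).
[cite: Zhang2022LandauSiegel, §16 p. 89] -/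
theorem powI_mul (b : ℝ) {m n : ℕ} (hm : m ≠ 0) (hn : n ≠ 0) :
    powI b (m * n) = powI b m * powI b n := by
  rw [powI_apply_of_ne_zero b (mul_ne_zero hm hn), powI_apply_of_ne_zero b hm,
    powI_apply_of_ne_zero b hn, Nat.cast_mul, Complex.natCast_mul_natCast_cpow]

/-- `(qʲ)^{−ib} = (q^{−ib})ʲ` (`q ≥ 1`): the local coefficients of `ζ(s+β₁)` (§16 p. 89).
[cite: Zhang2022LandauSiegel, §16 p. 89] -/
theorem powI_prime_pow (b : ℝ) {q : ℕ} (hq : q ≠ 0) (j : ℕ) :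
    powI b (q ^ j) = powI b q ^ j := by
  induction j with
  | zero => rw [pow_zero, pow_zero]; exact (isMultiplicative_powI b).map_one
  | succ j ih => rw [pow_succ, powI_mul b (pow_ne_zero j hq) hq, ih, pow_succ]

/-- **`κ₂(qʲ⁺¹) = (q^{−ib₁})ʲ (q^{−ib₁} − 1)`** for a prime `q`: the coefficients of `ζ(s+β₁)/ζ(s)` at
prime powers (App. A p. 105, "`|κ₂(qʳ)| = |q^{−β₁} − 1|`"). [cite: Zhang2022LandauSiegel, App. A p. 105] -/
theorem kappa₂_apply_prime_pow_succ (b : ℝ) {q : ℕ} (hq : q.Prime) (j : ℕ) :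
    kappa₂ b (q ^ (j + 1)) = powI b q ^ j * (powI b q - 1) := by
  rw [kappa₂, RankinEisenstein.mul_apply_prime_pow _ _ hq, Finset.sum_range_succ,
    Finset.sum_range_succ, Nat.sub_self, pow_zero, Nat.add_sub_cancel_left, pow_one,
    ArithmeticFunction.intCoe_apply, ArithmeticFunction.intCoe_apply,
    ArithmeticFunction.moebius_apply_prime hq, ArithmeticFunction.moebius_apply_one]
  have h0 : ∑ i ∈ Finset.range j,
      powI b (q ^ i) * (moebius : ArithmeticFunction ℂ) (q ^ (j + 1 - i)) = 0 := by
    refine Finset.sum_eq_zero fun i hi => ?_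
    have hi' : i < j := Finset.mem_range.mp hi
    have h2 : ¬ Squarefree (q ^ (j + 1 - i)) := by
      obtain ⟨k, hk⟩ : ∃ k, j + 1 - i = k + 2 := ⟨j - 1 - i, by omega⟩
      rw [hk, pow_add]
      exact fun h => hq.one_lt.ne' (Nat.isUnit_iff.mp (h q ⟨q ^ k, by ring⟩))
    rw [ArithmeticFunction.intCoe_apply, ArithmeticFunction.moebius_eq_zero_of_not_squarefree h2,
      Int.cast_zero, mul_zero]
  rw [h0, zero_add, powI_prime_pow b hq.ne_zero, powI_prime_pow b hq.ne_zero]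
  push_cast
  ring

/-- **`|κ₂(qʳ)| = |q^{−β₁} − 1|`** for `r ≥ 1` (App. A p. 105, tex L5200).
[cite: Zhang2022LandauSiegel, App. A p. 105] -/
theorem norm_kappa₂_prime_pow_succ (b : ℝ) {q : ℕ} (hq : q.Prime) (j : ℕ) :
    ‖kappa₂ b (q ^ (j + 1))‖ = ‖powI b q - 1‖ := by
  rw [kappa₂_apply_prime_pow_succ b hq j, norm_mul, norm_pow, norm_powI_of_pos b hq.pos, one_pow,
    one_mul]

/-- **`|κ₂(qʳ)| ≪ α log q`**: precisely `‖κ₂(qʳ)‖ ≤ |b₁| log q` for `r ≥ 1` (App. A p. 105, tex L5200;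
`β₁ = ib₁`). [cite: Zhang2022LandauSiegel, App. A p. 105] -/
theorem norm_kappa₂_prime_pow_succ_le (b : ℝ) {q : ℕ} (hq : q.Prime) (j : ℕ) :
    ‖kappa₂ b (q ^ (j + 1))‖ ≤ |b| * Real.log q := by
  rw [norm_kappa₂_prime_pow_succ b hq j]
  exact norm_powI_sub_one_le b hq.pos

/-- `κ₂(1) = 1` (§16 p. 89). [cite: Zhang2022LandauSiegel, §16 p. 89] -/
theorem kappa₂_apply_one (b : ℝ) : kappa₂ b 1 = 1 := (isMultiplicative_kappa₂ b).map_one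

/-- `‖κ₂(qʲ)‖ ≤ 2` at every prime power (crude form of "`|κ₂(qʳ)| = |q^{−β₁}−1|`", App. A p. 105).
[cite: Zhang2022LandauSiegel, App. A p. 105] -/
theorem norm_kappa₂_prime_pow_le_two (b : ℝ) {q : ℕ} (hq : q.Prime) (j : ℕ) :
    ‖kappa₂ b (q ^ j)‖ ≤ 2 := by
  rcases j with _ | j
  · rw [pow_zero, kappa₂_apply_one, norm_one]; norm_num
  · rw [norm_kappa₂_prime_pow_succ b hq j]
    calc ‖powI b q - 1‖ ≤ ‖powI b q‖ + ‖(1 : ℂ)‖ := norm_sub_le _ _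
      _ = 2 := by rw [norm_powI_of_pos b hq.pos, norm_one]; norm_num


/-! ## §2. Series over `𝔫(qʳ)` and the closed form of `κ̃₂(qʳ;d)` (App. A p. 105, (16.7)) -/

/-- For a prime `q` and `r ≥ 1`, `h ∈ 𝔫(qʳ)` iff `h` is a power of `q` (§7 p. 13: "`h ∈ 𝔫(d)` iff
every prime factor of `h` divides `d`"). [cite: Zhang2022LandauSiegel, §7 p. 13] -/
theorem mem_nset_prime_pow_iff {q r : ℕ} (hq : q.Prime) (hr : r ≠ 0) (h : ℕ) :
    h ∈ Skeleton.nset (q ^ r) ↔ ∃ i : ℕ, h = q ^ i := by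
  constructor
  · rintro ⟨hpos, hdiv⟩
    exact ⟨h.primeFactorsList.length, Nat.eq_prime_pow_of_unique_prime_dvd hpos.ne' fun {p} hp hph =>
      (Nat.prime_dvd_prime_iff_eq hp hq).mp (hp.dvd_of_dvd_pow (hdiv p hp hph))⟩
  · rintro ⟨i, rfl⟩
    exact ⟨pow_pos hq.pos i, fun p hp hpi => dvd_pow (hp.dvd_of_dvd_pow hpi) hr⟩

open scoped Classical in
/-- **A series over `h ∈ 𝔫(qʳ)` is a series over `h = qⁱ`** (`q` prime, `r ≥ 1`): the reindexing
behind "`κ̃₂(qʳ;d) = Σ_{h∈𝔫(qʳ),(h,d)=1} κ₂(qʳh)χ(h)/h`" at a prime power (§16 p. 90; classical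
decidability, as in the typed `kappaTilde` series). [cite: Zhang2022LandauSiegel, §16 p. 90] -/
theorem tsum_nset_prime_pow {q r : ℕ} (hq : q.Prime) (hr : r ≠ 0) (P : ℕ → Prop)
    (g : ℕ → ℂ) :
    (∑' h : ℕ, if h ∈ Skeleton.nset (q ^ r) ∧ P h then g h else 0) =
      ∑' i : ℕ, if P (q ^ i) then g (q ^ i) else 0 := by
  classical
  set f : ℕ → ℂ := fun h => if h ∈ Skeleton.nset (q ^ r) ∧ P h then g h else 0 with hf
  have hmem : ∀ i, q ^ i ∈ Skeleton.nset (q ^ r) := fun i =>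
    (mem_nset_prime_pow_iff hq hr _).mpr ⟨i, rfl⟩
  have h1 : (fun i : ℕ => f (q ^ i)) = fun i => if P (q ^ i) then g (q ^ i) else 0 := by
    funext i; simp only [hf, hmem i, true_and]
  rw [← h1]
  have hsupp : Function.support f ⊆ Set.range (q ^ ·) := fun h hh => by
    rw [Function.mem_support] at hh
    by_contra hrange
    apply hh
    simp only [hf]
    rw [if_neg]
    rintro ⟨hn, -⟩
    obtain ⟨i, rfl⟩ := (mem_nset_prime_pow_iff hq hr h).mp hn
    exact hrange ⟨i, rfl⟩
  exact ((Nat.pow_right_injective hq.two_le).tsum_eq (f := f) hsupp).symm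

/-- **`κ̃₂(qʳ⁺¹;d)` in closed form when `(q,d) = 1`**: `Σ_{i≥0} κ₂(q^{r+1+i}) zⁱ = wʳ(w−1)/(1 − wz)`
for `‖z‖ < 1` (`w = q^{−ib₁}`; at `z = χ(q)/q` this is the manuscript's `κ̃₂(qʳ⁺¹;d)`, App. A
p. 105 with (16.7)). [cite: Zhang2022LandauSiegel, App. A p. 105] -/
theorem tsum_kappa₂_prime_pow_mul_pow (b : ℝ) {q : ℕ} (hq : q.Prime) (r : ℕ) {z : ℂ}
    (hz : ‖z‖ < 1) :
    ∑' i : ℕ, kappa₂ b (q ^ (r + 1 + i)) * z ^ i =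
      powI b q ^ r * (powI b q - 1) / (1 - powI b q * z) := by
  have hw : ‖powI b q‖ = 1 := norm_powI_of_pos b hq.pos
  have hwz : ‖powI b q * z‖ < 1 := by rw [norm_mul, hw, one_mul]; exact hz
  have key : ∀ i : ℕ, kappa₂ b (q ^ (r + 1 + i)) * z ^ i =
      powI b q ^ r * (powI b q - 1) * (powI b q * z) ^ i := fun i => by
    rw [show r + 1 + i = (r + i) + 1 by ring, kappa₂_apply_prime_pow_succ b hq]; ring
  simp_rw [key]
  rw [tsum_mul_left, tsum_geometric_of_norm_lt_one hwz, div_eq_mul_inv]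

/-- `Σ_{i≥0} κ₂(q^{r+1+i}) zⁱ` is (absolutely) summable for `‖z‖ < 1` (the series `κ̃₂(qʳ⁺¹;d)`,
§16 p. 90). [cite: Zhang2022LandauSiegel, §16 p. 90] -/
theorem summable_kappa₂_prime_pow_mul_pow (b : ℝ) {q : ℕ} (hq : q.Prime) (r : ℕ) {z : ℂ}
    (hz : ‖z‖ < 1) : Summable fun i : ℕ => kappa₂ b (q ^ (r + 1 + i)) * z ^ i := by
  have hw : ‖powI b q‖ = 1 := norm_powI_of_pos b hq.pos
  have hwz : ‖powI b q * z‖ < 1 := by rw [norm_mul, hw, one_mul]; exact hz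
  have key : ∀ i : ℕ, kappa₂ b (q ^ (r + 1 + i)) * z ^ i =
      powI b q ^ r * (powI b q - 1) * (powI b q * z) ^ i := fun i => by
    rw [show r + 1 + i = (r + i) + 1 by ring, kappa₂_apply_prime_pow_succ b hq]; ring
  simp_rw [key]
  exact (summable_geometric_of_norm_lt_one hwz).mul_left _

end Literature.NumberTheory.LFunctions.Zhang2022.AppendixA
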